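import Literature.NumberTheory.EllipticCurves.SelmerPInftyRelModelAction
import Literature.NumberTheory.EllipticCurves.IwasawaSelmerControl
import Literature.NumberTheory.EllipticCurves.BSDSelmerParityDokchitserHeegnerFieldProofs
import Literature.NumberTheory.EllipticCurves.GeomPointsGaloisModule
import Literature.NumberTheory.GaloisRepresentations.LocalKroneckerWeberInertiaProofs
import HarnessLib

/-!
# T-E3g-BUDn-K (i): the SEAM `galRange (κ.layer n) = κ.layerSubgroup n` for a `ℤ_p`-extension of a
# number field (r2 ROUTE-2 §II.17 D-n.5; r2's `route2/g11/BUDnSeamCheck.lean` statement VERBATIM)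
# (cell `b2b-bsdres`, team n1011, seat p01 GEN 2; lead GEN 6 R5-46 deal)

HONEST FRAMING (cell `b2b-bsdres`, verbatim in every file): prove what is provable now; nothing is
booked; no label changes. Infrastructure (Galois theory of the `ℤ_p`-tower); THEOREMS ONLY (the
`NumberField`/`IsGalois` instances on the layer are the tree's
`ZpExtension.numberField_layer`/`isGalois_layer_inst`); NO Literature fact. The image of `Γ_{K_n} → Γ_K` (the tree's `galRange`, defined through the chosen embedding
`K̄ → K̄_{K_n}`) is EXACTLY `κ⁻¹(pⁿℤ_p)`: `galRange L = Γ_{L̃}` for `L/K` finite Galois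
(`galRange_eq_galSubgroupClosure`), `L̃ = K_n` for the (Galois) layer (`normalClosure_of_normal`), and
Krull (`fixingSubgroup_layer`). Consequence: `κ ∘ resGal K_n` lands in `pⁿ ℤ_p` (r2's Option B input),
and (ii) the RESTRICTED TOWER `κ_n := p^{-n}·(κ ∘ resGal K_n) : ZpExtension K_n p` exists
(`exists_restrictTower`, r2 II.17.7 Option B statement VERBATIM); (ii′) for ANY `κ_n` with
`κ_n·pⁿ = κ ∘ resGal K_n`: `ker κ_n = resGal⁻¹(ker κ)` and `resGal(ker κ_n) = ker κ`
(`K_{n,∞} = K_∞`), layers shift by `n` (`K_{n,m} = K_{n+m}`), and `κ` cyclotomic ⇒ `κ_n` cyclotomic.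

References: [Washington1997] §13.1; [SerreGaloisCohomology1997] II.§1.1.
-/

noncomputable section

open Literature.NumberTheory.EllipticCurves

universe u

namespace Summit.BirchSwinnertonDyer.Rank1Residual.Additive.ZpTower

variable {K : Type u} [Field K] [NumberField K] {p : ℕ} [Fact p.Prime]

/-- **SEAM (r2 II.17 D-n.5).** For a `ℤ_p`-extension `κ` of a number field `K` and `n : ℕ`, the image
of `Γ_{K_n} → Γ_K` is `κ⁻¹(pⁿ ℤ_p)`: `galRange (κ.layer n) = κ.layerSubgroup n`.
[cite: Washington1997, §13.1] [cite: SerreGaloisCohomology1997, II.§1.1] -/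
theorem galRange_layer_eq_layerSubgroup (κ : ZpExtension K p) (n : ℕ) :
    galRange (K := K) (κ.layer n) = κ.layerSubgroup n := by
  rw [RelModel.galRange_eq_galSubgroupClosure (K := K) (κ.layer n)]
  change (galoisClosureIn (K := K) (κ.layer n)).fixingSubgroup = _
  have hcl : galoisClosureIn (K := K) (κ.layer n) = κ.layer n := by
    unfold galoisClosureIn
    exact IntermediateField.normalClosure_of_normal (κ.layer n)
  rw [hcl, κ.fixingSubgroup_layer n]
  ext σ
  simp only [Subgroup.mem_map, MulEquiv.coe_toMonoidHom]
  constructor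
  · rintro ⟨τ, hτ, rfl⟩
    exact hτ
  · intro hσ
    exact ⟨σ, hσ, rfl⟩

/-- Hence `κ ∘ resGal K_n` lands in `pⁿ ℤ_p` (r2's Option B input). [cite: Washington1997, §13.1] -/
theorem pow_dvd_kappa_resGal_layer (κ : ZpExtension K p) (n : ℕ)
    (σ : Field.absoluteGaloisGroup (κ.layer n)) :
    (p : ℤ_[p]) ^ n ∣ (κ (resGal (K := K) (κ.layer n) σ)).toAdd := by
  have h : resGal (K := K) (κ.layer n) σ ∈ κ.layerSubgroup n := by
    rw [← galRange_layer_eq_layerSubgroup κ n]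
    exact ⟨σ, rfl⟩
  exact ZpExtension.mem_layerSubgroup.mp h


/-! ### (ii) The RESTRICTED TOWER `κ_n := p^{-n}·(κ ∘ resGal K_n)` (r2 II.17.7, Option B) -/

/-- **Restricted tower.** For a `ℤ_p`-extension `κ` of a number field `K` and `n : ℕ` there is a
`ℤ_p`-extension `κ_n` of the layer `K_n` with `κ_n(σ)·pⁿ = κ(σ|_{K̄})` for all `σ ∈ Γ_{K_n}`
(`K_{n,∞} = K_∞`): `κ ∘ resGal K_n` lands in `pⁿ ℤ_p` (the seam) and `ℤ_p` is a domain, so division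
by `pⁿ` defines a group homomorphism; it is continuous because multiplication by `pⁿ` is a closed
embedding of the compact `ℤ_p` (`Continuous.isClosedEmbedding`, `IsEmbedding.continuous_iff`), and
surjective because `κ` is and `κ⁻¹(pⁿℤ_p) = galRange K_n` (the seam again).
[cite: Washington1997, §13.1] -/
theorem exists_restrictTower (κ : ZpExtension K p) (n : ℕ) :
    ∃ κn : ZpExtension (κ.layer n) p,
      ∀ σ : Field.absoluteGaloisGroup (κ.layer n),
        (κn σ).toAdd * (p : ℤ_[p]) ^ n = (κ (resGal (K := K) (κ.layer n) σ)).toAdd := by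
  have hp0 : ((p : ℤ_[p]) ^ n) ≠ 0 := pow_ne_zero n (Nat.cast_ne_zero.mpr (Fact.out : p.Prime).ne_zero)
  -- the quotient function
  have hdiv := pow_dvd_kappa_resGal_layer κ n
  choose f hf using hdiv
  -- `hf σ : (κ (resGal σ)).toAdd = p ^ n * f σ`
  have hmul : ∀ σ τ, f (σ * τ) = f σ + f τ := fun σ τ => by
    apply mul_left_cancel₀ hp0
    rw [mul_add, ← hf, ← hf, ← hf, map_mul, map_mul, toAdd_mul]
  have hone : f 1 = 0 := by
    apply mul_left_cancel₀ hp0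
    rw [← hf, map_one, map_one, toAdd_one, mul_zero]
  -- continuity: `σ ↦ p^n * f σ` is continuous and `x ↦ p^n * x` is a closed embedding
  have hemb : Topology.IsClosedEmbedding (fun x : ℤ_[p] => (p : ℤ_[p]) ^ n * x) :=
    (continuous_const.mul continuous_id).isClosedEmbedding (mul_right_injective₀ hp0)
  have hcont : Continuous f := by
    rw [hemb.isEmbedding.continuous_iff]
    have h1 : (fun x : ℤ_[p] => (p : ℤ_[p]) ^ n * x) ∘ f =
        fun σ => (κ (resGal (K := K) (κ.layer n) σ)).toAdd := by
      funext σ; exact (hf σ).symm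
    rw [h1]
    exact continuous_toAdd.comp
      ((map_continuous κ.toContinuousMonoidHom).comp (resGal (K := K) (κ.layer n)).continuous)
  let g : Field.absoluteGaloisGroup (κ.layer n) →ₜ* Multiplicative ℤ_[p] :=
    { toFun := fun σ => Multiplicative.ofAdd (f σ)
      map_one' := by rw [hone]; rfl
      map_mul' := fun σ τ => by rw [hmul]; rfl
      continuous_toFun := continuous_ofAdd.comp hcont }
  have hg : ∀ σ, g σ = Multiplicative.ofAdd (f σ) := fun _ => rfl
  -- surjectivity
  have hsurj : Function.Surjective g := by
    intro z
    obtain ⟨τ, hτ⟩ := κ.surjective (Multiplicative.ofAdd ((p : ℤ_[p]) ^ n * z.toAdd))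
    have hτmem : τ ∈ κ.layerSubgroup n := by
      rw [ZpExtension.mem_layerSubgroup]
      refine ⟨z.toAdd, ?_⟩
      rw [show κ τ = κ.toContinuousMonoidHom τ from rfl, hτ]
      rfl
    rw [← galRange_layer_eq_layerSubgroup κ n] at hτmem
    obtain ⟨σ, hσ⟩ := hτmem
    have hσ' : resGal (K := K) (κ.layer n) σ = τ := hσ
    refine ⟨σ, ?_⟩
    apply Multiplicative.toAdd.injective
    apply mul_left_cancel₀ hp0
    rw [hg, toAdd_ofAdd, ← hf, hσ', show κ τ = κ.toContinuousMonoidHom τ from rfl, hτ, toAdd_ofAdd]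
  refine ⟨⟨g, hsurj⟩, fun σ => ?_⟩
  change (g σ).toAdd * (p : ℤ_[p]) ^ n = _
  rw [hg, toAdd_ofAdd, mul_comm, ← hf]


/-! ### (ii′) Bookkeeping for ANY restricted tower `κ_n` (`κ_n·pⁿ = κ ∘ resGal K_n`):
kernels, layers and cyclotomicity transport along `resGal K_n` (r2 II.17.7: "`ker κ_n =
resGal⁻¹(ker κ)`, so `κ_n.top = K_∞`"; the group-level half of T-res) -/

section RestrictTower

variable (κ : ZpExtension K p) (n : ℕ) (κn : ZpExtension (κ.layer n) p)
  (hκn : ∀ σ : Field.absoluteGaloisGroup (κ.layer n),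
    (κn σ).toAdd * (p : ℤ_[p]) ^ n = (κ (resGal (K := K) (κ.layer n) σ)).toAdd)
include hκn

omit [NumberField K] in
/-- `ker κ_n = resGal⁻¹(ker κ)`: `σ ∈ ker κ_n ↔ σ|_{K̄} ∈ ker κ` (`ℤ_p` is a domain, `pⁿ ≠ 0`).
[cite: Washington1997, §13.1] -/
theorem mem_kerSubgroup_restrictTower_iff (σ : Field.absoluteGaloisGroup (κ.layer n)) :
    σ ∈ κn.kerSubgroup ↔ resGal (K := K) (κ.layer n) σ ∈ κ.kerSubgroup := by
  have hp0 : ((p : ℤ_[p]) ^ n) ≠ 0 := pow_ne_zero n (Nat.cast_ne_zero.mpr (Fact.out : p.Prime).ne_zero)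
  rw [ZpExtension.mem_kerSubgroup, ZpExtension.mem_kerSubgroup, ← toAdd_eq_zero, ← toAdd_eq_zero,
    ← hκn σ, mul_eq_zero, or_iff_left hp0]

omit [NumberField K] in
/-- Layers of the restricted tower are layers of the original one, shifted by `n`:
`σ ∈ κ_n⁻¹(p^m ℤ_p) ↔ σ|_{K̄} ∈ κ⁻¹(p^{n+m} ℤ_p)` (`K_{n,m} = K_{n+m}`). [cite: Washington1997, §13.1] -/
theorem mem_layerSubgroup_restrictTower_iff (m : ℕ) (σ : Field.absoluteGaloisGroup (κ.layer n)) :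
    σ ∈ κn.layerSubgroup m ↔ resGal (K := K) (κ.layer n) σ ∈ κ.layerSubgroup (n + m) := by
  have hp0 : ((p : ℤ_[p]) ^ n) ≠ 0 := pow_ne_zero n (Nat.cast_ne_zero.mpr (Fact.out : p.Prime).ne_zero)
  rw [ZpExtension.mem_layerSubgroup, ZpExtension.mem_layerSubgroup, ← hκn σ, pow_add, mul_comm]
  exact (mul_dvd_mul_iff_right hp0).symm

/-- `resGal K_n` maps `ker κ_n` ONTO `ker κ` (`ker κ ≤ κ⁻¹(pⁿℤ_p) = galRange K_n`, the seam).
[cite: Washington1997, §13.1] -/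
theorem map_kerSubgroup_restrictTower :
    κn.kerSubgroup.map (resGal (K := K) (κ.layer n)).toMonoidHom = κ.kerSubgroup := by
  ext τ
  constructor
  · rintro ⟨σ, hσ, rfl⟩
    exact (mem_kerSubgroup_restrictTower_iff κ n κn hκn σ).mp hσ
  · intro hτ
    have hτ' : τ ∈ galRange (K := K) (κ.layer n) := by
      rw [galRange_layer_eq_layerSubgroup κ n]
      exact κ.kerSubgroup_le_layerSubgroup n hτ
    obtain ⟨σ, hσ⟩ := hτ'
    have hσ' : resGal (K := K) (κ.layer n) σ = τ := hσ
    refine ⟨σ, ?_, hσ'⟩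
    show σ ∈ κn.kerSubgroup
    rw [mem_kerSubgroup_restrictTower_iff κ n κn hκn σ, hσ']
    exact hτ

/-- `resGal K_n` maps the `m`-th layer subgroup of `κ_n` ONTO the `(n+m)`-th of `κ`
(`κ⁻¹(p^{n+m}ℤ_p) ≤ κ⁻¹(pⁿℤ_p) = galRange K_n`). [cite: Washington1997, §13.1] -/
theorem map_layerSubgroup_restrictTower (m : ℕ) :
    (κn.layerSubgroup m).map (resGal (K := K) (κ.layer n)).toMonoidHom =
      κ.layerSubgroup (n + m) := by
  ext τ
  constructor
  · rintro ⟨σ, hσ, rfl⟩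
    exact (mem_layerSubgroup_restrictTower_iff κ n κn hκn m σ).mp hσ
  · intro hτ
    have hτ' : τ ∈ galRange (K := K) (κ.layer n) := by
      rw [galRange_layer_eq_layerSubgroup κ n]
      exact κ.layerSubgroup_antitone (Nat.le_add_right n m) hτ
    obtain ⟨σ, hσ⟩ := hτ'
    have hσ' : resGal (K := K) (κ.layer n) σ = τ := hσ
    refine ⟨σ, ?_, hσ'⟩
    show σ ∈ κn.layerSubgroup m
    rw [mem_layerSubgroup_restrictTower_iff κ n κn hκn m σ, hσ']
    exact hτ

/-- **Cyclotomicity transports to the restricted tower**: if `κ` is the cyclotomic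
`ℤ_p`-extension of `K` (`ker κ = χ_p⁻¹(μ(ℤ_p))`), then `κ_n` is the cyclotomic `ℤ_p`-extension of
`K_n` — `χ_p` is compatible with restriction (`cyclotomicCharacter_absGaloisRestrict`;
`resGal = absGaloisRestrict`). [cite: Washington1997, §13.1] -/
theorem isCyclotomic_restrictTower (hcyc : κ.IsCyclotomic) : κn.IsCyclotomic := by
  unfold ZpExtension.IsCyclotomic at hcyc ⊢
  ext σ
  rw [mem_kerSubgroup_restrictTower_iff κ n κn hκn σ, hcyc, Subgroup.mem_comap, Subgroup.mem_comap]
  haveI : NeZero (p : K) := ⟨Nat.cast_ne_zero.mpr (Fact.out : p.Prime).ne_zero⟩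
  change Literature.NumberTheory.GaloisRepresentations.GaloisRep.cyclotomicCharacter K p
      (resGal (K := K) (κ.layer n) σ) ∈ CommGroup.torsion ℤ_[p]ˣ ↔
    Literature.NumberTheory.GaloisRepresentations.GaloisRep.cyclotomicCharacter (κ.layer n) p σ ∈
      CommGroup.torsion ℤ_[p]ˣ
  rw [WeierstrassCurve.resGal_eq_absGaloisRestrict,
    Literature.NumberTheory.GaloisRepresentations.cyclotomicCharacter_absGaloisRestrict]

end RestrictTower

end Summit.BirchSwinnertonDyer.Rank1Residual.Additive.ZpTower

end
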